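import Summits.Ventures.HSemireg.WedgeHankelKernelAdditiveRank
import Summits.Ventures.HSemireg.WedgeHankelKernelColumnSpaceNodes
import Summits.Ventures.HSemireg.WedgeHankelDivisorRank
import Literature.LinearAlgebra.IndependentSubspacesDimension

/-!
# Venture HSemireg — THE COLUMN SPACE OF A DIVISOR CLASS IS THE DIRECT SUM OF THE OSCULATING FLATS OF ITS NODES: for distinct nodes `λ_i` with classes `exp(λ_i Θ)·q_i` of exact orders
# `P_i + 1` and total order `D = Σ_i (P_i + 1) ≤ min(k + 1, N + 1 − k)`, F2a's rank law reads «the Hankel rank is ADDITIVE» (`rank H_k(Σ) = D = Σ_i (P_i + 1) = Σ_i rank H_k(node_i)`), so the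
# additive rank law (N3) and the osculating flats (N4) give **`col H_k(Σ_i exp(λ_i Θ)·q_i) = ⨁_i span{o_t(λ_i) : t ≤ P_i}`, a DIRECT sum — osculating flats at distinct points of the rational
# normal curve of total dimension `≤ min(k+1, N+1−k)` are independent**

HONEST FRAMING. Part of the Lean index of the computation cell `pub-hsemireg` (seat p10 gen 25, Sunday typer «UNIFORM-IN-n»).
Finite-dimensional EXTERIOR ALGEBRA over a field + ranks / column spaces of Hankel matrices ONLY: no variety, no cohomology theory, no sheaf, no Ext group, no semiregularity map;
nothing here says that HC / HC_CM / HC_AV holds; no Literature fact is declared or used beyond `Literature.LinearAlgebra.IndependentSubspacesDimension` (Hoffman–Kunze §6.6, proved).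
Custodian versions as in `WedgeHankelSiegelIdeal` (1/3) and `WedgeHankelFrameChange`; the dictionary (divisor `Σ_i (P_i+1)[λ_i]` of a class; `o_t(λ) = (C(a,t) λ^{a−t})_a` the osculating
vectors at the Veronese point `ν_k(λ)`) is QUOTED, never asserted.

WHAT IS IN THE TREE / KEYED.  F2a (`WedgeHankelDivisorRank`) `rank_hankel1_expMul_sum` (`rank H_k(Σ_i expMul λ_i q_i) = Σ_i (P_i + 1)` for `D ≤ k + 1`, `D ≤ N + 1 − k`; confluent Vandermonde);
E6 `rank_hankel1_expMul_of_order` (one node: `min(P,k) + 1`); N3 (`WedgeHankelKernelAdditiveRank`, keyed) `rank_hank_eq_sum_rank_of_eq_sum`, `range_hankel1_sum_eq_iSup_of_rank`,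
`rank_hankel1_sum_eq_rank_hank_of_eq_sum`; N4 (`WedgeHankelKernelColumnSpaceNodes`, keyed) `range_hankel1_mulVecLin_expMul_of_order` (the osculating flat of one node); M14
`rank_hank_eq_finrank_iSup_range`; F2b/F2d/H6 (the kernel and image laws of a divisor — NOT re-derived here).
THIS FILE (namespace `Summit.Ventures.HSemireg.Wedge.HankelOuter` continued; CHAINED on N3 and N4):
* §445 `sum_expMul_eq` (the pointwise sum of F2a is the `Π`-sum of N3), **`rank_hankel1_expMul_sum_eq_sum_rank`** (F2a as ADDITIVE RANK: `rank H_k(Σ_i node_i) = Σ_i rank H_k(node_i)`),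
  **`range_hankel1_mulVecLin_expMul_sum`** (`col H_k(Σ_i expMul λ_i q_i) = ⨆_i col H_k(expMul λ_i q_i)`), **`range_hankel1_mulVecLin_expMul_sum_eq_iSup_span`** (`= ⨆_i span{o_t(λ_i) : t ≤ P_i}`,
  with `min(P_i, k) = P_i`), `finrank_iSup_range_hankel1_expMul` (the sum has dimension `D`), **`iSupIndep_range_hankel1_expMul`** (THE OSCULATING FLATS AT DISTINCT NODES ARE INDEPENDENT,
  total dimension `D ≤ min(k+1, N+1−k)`).
READING: the divisor laws of the atlas come from ONE rank statement (F2a) through the additive rank law; on the column side they say that the secant/cactus point `Σ_i osc_{P_i}(λ_i)` of the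
rational normal curve has the expected dimension.  NOT typed here: the node at `∞` among finite nodes (F3a gives the rank; same two lines), the fourth regime.  Nothing Ext-side.  New names only.
-/

open Module

namespace Summit.Ventures.HSemireg.Wedge.HankelOuter

open Summit.Ventures.HSemireg.Wedge Summit.Ventures.HSemireg.Wedge.Kunneth Summit.Ventures.HSemireg.Wedge.Hankel
  Summit.Ventures.HSemireg.Wedge.BasisFree Summit.Ventures.HSemireg.Wedge.HankelSiegel Summit.Ventures.HSemireg.Wedge.HankelSiegelIdeal
  Summit.Ventures.HSemireg.Wedge.KunnethKernel Summit.Ventures.HSemireg.Wedge.HankelFrameChange Summit.Ventures.HSemireg.Wedge.KernelDuality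

variable (K : Type*) [Field K] {N : ℕ}

/-! ## §445. Divisor classes: the column space is the direct sum of the osculating flats -/

/-- the pointwise sum of F2a is the `Π`-sum of N3: `(j ↦ Σ_i expMul λ_i q_i j) = Σ_i expMul λ_i q_i`. -/
theorem sum_expMul_eq {r : ℕ} (lam : Fin r → K) (q : Fin r → ℕ → K) :
    (fun j => ∑ i, expMul K (lam i) (q i) j) = ∑ i, expMul K (lam i) (q i) := by
  funext j
  rw [Finset.sum_apply]

/-- **F2a AS ADDITIVE RANK: `rank H_k(Σ_i exp(λ_i Θ)·q_i) = Σ_i rank H_k(exp(λ_i Θ)·q_i)`** for distinct nodes, exact orders `P_i + 1`, total order `D ≤ k + 1`, `D ≤ N + 1 − k`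
(each node has rank `P_i + 1`, E6, and the sum has rank `D`, F2a). -/
theorem rank_hankel1_expMul_sum_eq_sum_rank {k r : ℕ} {lam : Fin r → K} (hlam : Function.Injective lam) {P : Fin r → ℕ} {q : Fin r → ℕ → K}
    (hq : ∀ i j, P i < j → q i j = 0) (hqP : ∀ i, q i (P i) ≠ 0) (hDk : ∑ i, (P i + 1) ≤ k + 1) (hDn : ∑ i, (P i + 1) ≤ N + 1 - k) :
    (hankel1 K N k (∑ i, expMul K (lam i) (q i))).rank = ∑ i, (hankel1 K N k (expMul K (lam i) (q i))).rank := by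
  rw [← sum_expMul_eq, rank_hankel1_expMul_sum K hlam hq hqP hDk hDn]
  refine Finset.sum_congr rfl fun i _ => ?_
  have hPi : P i + 1 ≤ ∑ i, (P i + 1) := Finset.single_le_sum (f := fun i => P i + 1) (fun _ _ => Nat.zero_le _) (Finset.mem_univ i)
  rw [rank_hankel1_expMul_of_order K (lam i) (by omega : k + P i ≤ N) (hq i) (hqP i), min_eq_left (by omega)]

/-- **`col H_k(Σ_i exp(λ_i Θ)·q_i) = ⨆_i col H_k(exp(λ_i Θ)·q_i)`** (same hypotheses): the additive rank law (N3) on F2a. -/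
theorem range_hankel1_mulVecLin_expMul_sum {k r : ℕ} {lam : Fin r → K} (hlam : Function.Injective lam) {P : Fin r → ℕ} {q : Fin r → ℕ → K}
    (hq : ∀ i j, P i < j → q i j = 0) (hqP : ∀ i, q i (P i) ≠ 0) (hDk : ∑ i, (P i + 1) ≤ k + 1) (hDn : ∑ i, (P i + 1) ≤ N + 1 - k) :
    LinearMap.range (hankel1 K N k (∑ i, expMul K (lam i) (q i))).mulVecLin = ⨆ i, LinearMap.range (hankel1 K N k (expMul K (lam i) (q i))).mulVecLin :=
  range_hankel1_sum_eq_iSup_of_rank K k _ (rank_hankel1_sum_eq_rank_hank_of_eq_sum K k _ (rank_hankel1_expMul_sum_eq_sum_rank K hlam hq hqP hDk hDn))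

/-- **THE COLUMN SPACE OF A DIVISOR CLASS IS THE SUM OF THE OSCULATING FLATS OF ITS NODES: `col H_k(Σ_i exp(λ_i Θ)·q_i) = ⨆_i span{o_t(λ_i) : t ≤ min(P_i, k)}`**
(`o_t(λ) = (C(a,t) λ^{a−t})_a`; here `min(P_i, k) = P_i` since `D ≤ k + 1`). -/
theorem range_hankel1_mulVecLin_expMul_sum_eq_iSup_span {k r : ℕ} {lam : Fin r → K} (hlam : Function.Injective lam) {P : Fin r → ℕ} {q : Fin r → ℕ → K}
    (hq : ∀ i j, P i < j → q i j = 0) (hqP : ∀ i, q i (P i) ≠ 0) (hDk : ∑ i, (P i + 1) ≤ k + 1) (hDn : ∑ i, (P i + 1) ≤ N + 1 - k) :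
    LinearMap.range (hankel1 K N k (∑ i, expMul K (lam i) (q i))).mulVecLin
      = ⨆ i, Submodule.span K (Set.range fun t : Fin (min (P i) k + 1) => fun a : Fin (k + 1) => ((((a : ℕ).choose (t : ℕ) : ℕ)) : K) * lam i ^ ((a : ℕ) - (t : ℕ))) := by
  rw [range_hankel1_mulVecLin_expMul_sum K hlam hq hqP hDk hDn]
  refine iSup_congr fun i => ?_
  have hPi : P i + 1 ≤ ∑ i, (P i + 1) := Finset.single_le_sum (f := fun i => P i + 1) (fun _ _ => Nat.zero_le _) (Finset.mem_univ i)
  exact range_hankel1_mulVecLin_expMul_of_order K (lam i) (by omega : k + P i ≤ N) (hq i) (hqP i)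

/-- the sum of the osculating flats has dimension `D = Σ_i (P_i + 1)`. -/
theorem finrank_iSup_range_hankel1_expMul {k r : ℕ} {lam : Fin r → K} (hlam : Function.Injective lam) {P : Fin r → ℕ} {q : Fin r → ℕ → K}
    (hq : ∀ i j, P i < j → q i j = 0) (hqP : ∀ i, q i (P i) ≠ 0) (hDk : ∑ i, (P i + 1) ≤ k + 1) (hDn : ∑ i, (P i + 1) ≤ N + 1 - k) :
    finrank K ↥(⨆ i, LinearMap.range (hankel1 K N k (expMul K (lam i) (q i))).mulVecLin) = ∑ i, (P i + 1) := by
  rw [← rank_hank_eq_finrank_iSup_range, rank_hank_eq_sum_rank_of_eq_sum K k _ (rank_hankel1_expMul_sum_eq_sum_rank K hlam hq hqP hDk hDn)]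
  refine Finset.sum_congr rfl fun i _ => ?_
  have hPi : P i + 1 ≤ ∑ i, (P i + 1) := Finset.single_le_sum (f := fun i => P i + 1) (fun _ _ => Nat.zero_le _) (Finset.mem_univ i)
  rw [rank_hankel1_expMul_of_order K (lam i) (by omega : k + P i ≤ N) (hq i) (hqP i), min_eq_left (by omega)]

/-- **THE OSCULATING FLATS AT DISTINCT NODES ARE INDEPENDENT: `iSupIndep (i ↦ col H_k(exp(λ_i Θ)·q_i))`** for distinct `λ_i`, exact orders `P_i + 1`, total order
`D ≤ min(k + 1, N + 1 − k)` — the sum has dimension `Σ_i dim` (Hoffman–Kunze's dimension criterion, `Literature.LinearAlgebra.iSupIndep_of_finrank_iSup_eq_sum`). -/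
theorem iSupIndep_range_hankel1_expMul {k r : ℕ} {lam : Fin r → K} (hlam : Function.Injective lam) {P : Fin r → ℕ} {q : Fin r → ℕ → K}
    (hq : ∀ i j, P i < j → q i j = 0) (hqP : ∀ i, q i (P i) ≠ 0) (hDk : ∑ i, (P i + 1) ≤ k + 1) (hDn : ∑ i, (P i + 1) ≤ N + 1 - k) :
    iSupIndep (fun i => LinearMap.range (hankel1 K N k (expMul K (lam i) (q i))).mulVecLin) := by
  refine Literature.LinearAlgebra.iSupIndep_of_finrank_iSup_eq_sum ?_
  rw [finrank_iSup_range_hankel1_expMul K hlam hq hqP hDk hDn]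
  refine Finset.sum_congr rfl fun i _ => ?_
  have hPi : P i + 1 ≤ ∑ i, (P i + 1) := Finset.single_le_sum (f := fun i => P i + 1) (fun _ _ => Nat.zero_le _) (Finset.mem_univ i)
  rw [← Matrix.rank, rank_hankel1_expMul_of_order K (lam i) (by omega : k + P i ≤ N) (hq i) (hqP i), min_eq_left (by omega)]

end Summit.Ventures.HSemireg.Wedge.HankelOuter
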